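import Literature.Computability.Cryptography.QuantumTuringMachineCircuitLayout
import Literature.Computability.QuantumComplexity.RevTableauUniform
import HarnessLib

/-!
# The simulating circuit family is polynomial-time uniform (a generator program prints its description)

Sixth file of the head-centred simulation of quantum Turing machines (`QuantumTuringMachineCircuitLayout.lean`: the
family `hcFamily M p` over the finite gate set `𝒢_M`). We prove `hcFamily_isUniform`: the description
`QCircuit.sigmaEncode ⟨n, anc n, hcCirc n⟩` is computed from `1ⁿ` in polynomial time. Following the tree's method
(`Complexity/GenPrograms.lean`, `Complexity/TokenStreams.lean`, as used in `QuantumComplexity/RevTableauUniform.lean`):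
no Turing machine is written — the description is the rendered stream of a *generator program* `descG` (literal
emission inside nested counted loops whose bounds and emitted numerals are polynomial expressions in `n` and the loop
indices; `GStmt.render_out_mem_FP`), and the proof is a list identity (`render_out_descG`). Ingredients:

* wire numbers of the layout (`θ_val_*`) and the wire lists of every placement (`ofFn_eW`, …, `ofFn_eSW`);
* descriptions of the placed gates (`gateEnc_gW`, …; `RevDesc.gateEnc_gate`), `encode_hcCirc` — the description of the
  `n`-th circuit is the concatenation of the bits of the triples `descTriples n` (loads, `p(n)` copies of
  `stepTriples`, readout, swaps); the left head move and the answer routing were laid out as INCREASING star words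
  (`csGatesL`, `finalGates`) precisely so that a counter program (no subtraction) can print them;
* the generator (`polyE` evaluates the polynomial `p`; `gateG`, `stepG`, `loadG`, `finalG`, `headerG`, `descG`),
  `out_descG`, `render_out_descG`, loop-variable hygiene (`xn_not_mem_loopVars_descG`, `noReuse_descG`).

Everything is proved; no named facts.

## References

* S. Arora, B. Barak, *Computational Complexity: A Modern Approach*, CUP 2009 [AroraBarak2009], §6.1–6.2
  (circuit descriptions, `P`-uniform families), proof of Thm. 6.15 ("keeping counters").
* H. Nishimura, M. Ozawa, Theoret. Comput. Sci. 276 (2002) [NishimuraOzawa2002], §4–§5 (uniform quantum circuit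
  families, `BUPQC`).
-/

noncomputable section

namespace Literature.Computability.Cryptography

open _root_.Computability Complexity Matrix
open Literature.Computability.QuantumComplexity (RevDesc.gateBits RevDesc.gateEnc RevDesc.gatePre RevDesc.wireBits
  RevDesc.litT RevDesc.wireToks RevDesc.gateToks)
open Literature.Computability.QuantumComplexity.RevDesc (encode_eq_flatMap gateEnc_gate render_gateToks fin_gateToks
  render_litT fin_litT dbl_encodeNat dbl_replicate unaryEncodeNat_eq_replicate)
open Literature.Computability.QuantumComplexity.RevSim (seqs out_seqs loopVars_seqs noReuse_seqs flatMap_range_const)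
open scoped BigOperators

namespace QTM

/-! ### Wire numbers of the layout -/

section wires

variable (M : QTM) (p : Polynomial ℕ) (n : ℕ)

/-- State-code wire `b` is wire `n + 1 + b`. [folklore] -/
theorem θ_val_ixSt (b : Fin M.kΛ) : (M.θ p n (ixSt b)).val = n + (1 + b.val) := by
  simp [θ, θA, ixSt, finSumFinEquiv_apply_left, finSumFinEquiv_apply_right]
  rfl

/-- The direction wire is wire `n + 1 + |Λ|`. [folklore] -/
theorem θ_val_ixD : (M.θ p n ixD).val = n + (1 + M.kΛ) := by
  simp [θ, θA, ixD, finSumFinEquiv_apply_left, finSumFinEquiv_apply_right]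
  show (Fin.castAdd 1 (Fin.natAdd (1 + M.kΛ) (0 : Fin 1))).val = 1 + M.kΛ
  simp

/-- The marker wire is wire `n + 2 + |Λ|`. [folklore] -/
theorem θ_val_ixE : (M.θ p n ixE).val = n + (1 + M.kΛ + 1) := by
  simp [θ, θA, ixE, finSumFinEquiv_apply_right]
  show (Fin.natAdd (1 + M.kΛ + 1) (0 : Fin 1)).val = 1 + M.kΛ + 1
  simp

/-- Bit `b` of cell block `j` is wire `n + 3 + |Λ| + j|Γ| + b`. [folklore] -/
theorem θ_val_ixCell (j : Fin (nw p n)) (b : Fin M.kΓ) :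
    (M.θ p n (ixCell j b)).val = n + (1 + M.kΛ + 1 + 1 + (b.val + M.kΓ * j.val)) := by
  simp [θ, θA, ixCell, finSumFinEquiv_apply_right]
  rfl

/-- Input wire `i` is wire `i` (as a number). [folklore] -/
theorem θ_val_ixIn (i : Fin n) : (M.θ p n (ixIn i)).val = i.val := by
  rw [show (ixIn i : M.Idx p n) = Sum.inl i from rfl]
  simp [θ]

end wires


/-! ### The wire lists of the placed gates -/

section wirelists

variable (M : QTM) (p : Polynomial ℕ) (n : ℕ)

/-- The number of state-code wire `b`. [folklore] -/
def wSt (b : ℕ) : ℕ := n + (1 + b)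
/-- The number of the direction wire. [folklore] -/
def wD : ℕ := n + (1 + M.kΛ)
/-- The number of the marker wire. [folklore] -/
def wE : ℕ := n + (1 + M.kΛ + 1)
/-- The number of bit `b` of cell block `j`. [folklore] -/
def wCell (j b : ℕ) : ℕ := n + (1 + M.kΛ + 1 + 1 + (b + M.kΓ * j))

/-- The wire numbers of the local step gate, pin by pin. [folklore] -/
def wiresW : List ℕ :=
  (List.range M.kΛ).map (wSt n) ++ (List.range M.kΓ).map (M.wCell n 0) ++ [M.wD n] ++ [M.wE n]
/-- The wire numbers of the erasure gate. [folklore] -/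
def wiresE : List ℕ := (List.range M.kΛ).map (wSt n) ++ [M.wD n] ++ [M.wE n]
/-- The wire numbers of a controlled swap of blocks `j₁`, `j₂`. [folklore] -/
def wiresCS (j₁ j₂ : ℕ) : List ℕ := [M.wD n] ++ (List.range M.kΓ).map (M.wCell n j₁) ++ (List.range M.kΓ).map (M.wCell n j₂)
/-- The wire numbers of the load gate of input bit `i`. [folklore] -/
def wiresLD (i : ℕ) : List ℕ := [i] ++ (List.range M.kΓ).map (M.wCell n i)
/-- The wire numbers of the readout gate. [folklore] -/
def wiresAC : List ℕ := (List.range M.kΛ).map (wSt n) ++ [n]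
/-- The wire numbers of the `k`-th final swap: `0` and `k + 1`. [folklore] -/
def wiresSW (k : ℕ) : List ℕ := [0] ++ [k + 1]

/-- `List.ofFn` over `Fin k` of a function of the value is a `map` over `range k`. [folklore] -/
theorem ofFn_val_eq_map_range {k : ℕ} (f : ℕ → ℕ) : (List.ofFn fun i : Fin k => f i.val) = (List.range k).map f := by
  rw [List.ofFn_eq_map, ← List.map_coe_finRange_eq_range, List.map_map]
  rfl

/-- The pins of `W` are the wires `wiresW n`. [folklore] -/
theorem ofFn_eW : (List.ofFn fun c => (M.eW p n c : ℕ)) = M.wiresW n := by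
  have key : (fun c => (M.eW p n c : ℕ)) =
      Fin.append (Fin.append (Fin.append (fun b : Fin M.kΛ => wSt n b.val) (fun b : Fin M.kΓ => M.wCell n 0 b.val))
        (fun _ : Fin 1 => M.wD n)) (fun _ : Fin 1 => M.wE n) := by
    funext c
    refine Fin.addCases (fun c => ?_) (fun c => ?_) c
    · rw [Fin.append_left]
      refine Fin.addCases (fun c => ?_) (fun c => ?_) c
      · rw [Fin.append_left]
        refine Fin.addCases (fun c => ?_) (fun c => ?_) c
        · rw [Fin.append_left]
          simp [eW, embOf, θLoc, locWires, θ_val_ixSt, wSt]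
        · rw [Fin.append_right]
          simp [eW, embOf, θLoc, locWires, θ_val_ixCell, wCell, cell0]
      · rw [Fin.append_right]
        simp [eW, embOf, θLoc, locWires, θ_val_ixD, wD]
    · rw [Fin.append_right]
      simp [eW, embOf, θLoc, locWires, θ_val_ixE, wE]
  rw [key, List.ofFn_fin_append, List.ofFn_fin_append, List.ofFn_fin_append, ofFn_val_eq_map_range,
    ofFn_val_eq_map_range, wiresW]
  simp

/-- The pins of `E` are the wires `wiresE n`. [folklore] -/
theorem ofFn_eE : (List.ofFn fun c => (M.eE p n c : ℕ)) = M.wiresE n := by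
  have key : (fun c => (M.eE p n c : ℕ)) =
      Fin.append (Fin.append (fun b : Fin M.kΛ => wSt n b.val) (fun _ : Fin 1 => M.wD n)) (fun _ : Fin 1 => M.wE n) := by
    funext c
    refine Fin.addCases (fun c => ?_) (fun c => ?_) c
    · rw [Fin.append_left]
      refine Fin.addCases (fun c => ?_) (fun c => ?_) c
      · rw [Fin.append_left]
        simp [eE, embOf, θEr, erWires, θ_val_ixSt, wSt]
      · rw [Fin.append_right]
        simp [eE, embOf, θEr, erWires, θ_val_ixD, wD]
    · rw [Fin.append_right]
      simp [eE, embOf, θEr, erWires, θ_val_ixE, wE]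
  rw [key, List.ofFn_fin_append, List.ofFn_fin_append, ofFn_val_eq_map_range, wiresE]
  simp

/-- The pins of a controlled swap are the wires `wiresCS n j₁ j₂`. [folklore] -/
theorem ofFn_eCS (j₁ j₂ : ℕ) (h₁ : j₁ < nw p n) (h₂ : j₂ < nw p n) (hne : j₁ ≠ j₂) :
    (List.ofFn fun c => (M.eCS p n j₁ j₂ h₁ h₂ hne c : ℕ)) = M.wiresCS n j₁ j₂ := by
  have key : (fun c => (M.eCS p n j₁ j₂ h₁ h₂ hne c : ℕ)) =
      Fin.append (Fin.append (fun _ : Fin 1 => M.wD n) (fun b : Fin M.kΓ => M.wCell n j₁ b.val))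
        (fun b : Fin M.kΓ => M.wCell n j₂ b.val) := by
    funext c
    refine Fin.addCases (fun c => ?_) (fun c => ?_) c
    · rw [Fin.append_left]
      refine Fin.addCases (fun c => ?_) (fun c => ?_) c
      · rw [Fin.append_left]
        simp [eCS, embOf, θCS, csWires, θ_val_ixD, wD]
      · rw [Fin.append_right]
        simp [eCS, embOf, θCS, csWires, θ_val_ixCell, wCell, cellAt]
    · rw [Fin.append_right]
      simp [eCS, embOf, θCS, csWires, θ_val_ixCell, wCell, cellAt]
  rw [key, List.ofFn_fin_append, List.ofFn_fin_append, ofFn_val_eq_map_range, ofFn_val_eq_map_range, wiresCS]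
  simp

/-- The pins of a load gate are the wires `wiresLD n i`. [folklore] -/
theorem ofFn_eLD (i : Fin n) : (List.ofFn fun c => (M.eLD p n i c : ℕ)) = M.wiresLD n i.val := by
  have key : (fun c => (M.eLD p n i c : ℕ)) =
      Fin.append (fun _ : Fin 1 => i.val) (fun b : Fin M.kΓ => M.wCell n i.val b.val) := by
    funext c
    refine Fin.addCases (fun c => ?_) (fun c => ?_) c
    · rw [Fin.append_left]
      simp [eLD, embOf, θLD, ldWires, θ_val_ixIn]
    · rw [Fin.append_right]
      simp [eLD, embOf, θLD, ldWires, θ_val_ixCell, wCell, cellAt]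
  rw [key, List.ofFn_fin_append, ofFn_val_eq_map_range, wiresLD]
  simp

/-- The pins of the readout gate are the wires `wiresAC n`. [folklore] -/
theorem ofFn_eAC : (List.ofFn fun c => (M.eAC p n c : ℕ)) = M.wiresAC n := by
  have key : (fun c => (M.eAC p n c : ℕ)) =
      Fin.append (fun b : Fin M.kΛ => wSt n b.val) (fun _ : Fin 1 => n) := by
    funext c
    refine Fin.addCases (fun c => ?_) (fun c => ?_) c
    · rw [Fin.append_left]
      simp [eAC, embOf, θAC, acWires, θ_val_ixSt, wSt]
    · rw [Fin.append_right]
      simp [eAC, embOf, θAC, acWires, θ_ixAns_val]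
  rw [key, List.ofFn_fin_append, ofFn_val_eq_map_range, wiresAC]
  simp

/-- The pins of a final swap are the wires `wiresSW k`. [folklore] -/
theorem ofFn_eSW (k : Fin n) : (List.ofFn fun c => (M.eSW p n k c : ℕ)) = wiresSW k.val := by
  rw [List.ofFn_succ, List.ofFn_succ, List.ofFn_zero]
  simp only [eSW, embOf, Equiv.refl_symm, Equiv.refl_apply, Function.Embedding.coeFn_mk, swWires,
    Fin.isValue, if_true, show (Fin.succ (0 : Fin 1) : Fin 2) = 1 from rfl, one_ne_zero, if_false]
  rw [θ_wireAt_val _ _ _ 0 (Nat.zero_le _), θ_wireAt_val _ _ _ (k.val + 1) k.2]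
  rfl

end wirelists


/-! ### Descriptions of the placed gates -/

section descriptions

variable (M : QTM) (p : Polynomial ℕ) (n : ℕ)

/-- The symbol codes of the machine-specific gates in `𝒢_M = cliffordT ⊕ HCOp` (`2·k + 1`). [folklore] -/
def hcCode : HCOp → ℕ
  | .W => 1 | .Winv => 3 | .E => 5 | .CS true => 7 | .CS false => 9 | .LOAD => 11 | .ACC => 13 | .SWAP => 15

/-- The `Encodable` code of a machine-specific gate symbol. [folklore] -/
theorem encode_inr_hcOp (g : HCOp) : Encodable.encode (α := M.hcGateSet.Op) (Sum.inr g) = hcCode g := by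
  show Encodable.encode (Sum.inr g : CliffordTOp ⊕ HCOp) = hcCode g
  rw [Encodable.encode_inr]
  rcases g with _ | _ | _ | (_ | _) | _ | _ | _ <;> rfl

/-- `flatMap` through a repeated block. [folklore] -/
theorem flatMap_flatten_replicate {α β : Type} (f : α → List β) (l : List α) :
    ∀ T : ℕ, (List.replicate T l).flatten.flatMap f = (List.replicate T (l.flatMap f)).flatten
  | 0 => rfl
  | T + 1 => by
    rw [List.replicate_succ, List.flatten_cons, List.flatMap_append, flatMap_flatten_replicate f l T,
      List.replicate_succ, List.flatten_cons]

/-- The description of the placed `W` gate (symbol code, arity in unary, wires in binary; Arora–Barak 2009, §6.1). [cite: AroraBarak2009, §6.1] -/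
theorem gateEnc_gW : RevDesc.gateEnc (M.gW p n) = RevDesc.gateBits 1 (M.kΛ + M.kΓ + 1 + 1) (M.wiresW n) := by
  rw [gW, gateEnc_gate, encode_inr_hcOp]
  show RevDesc.gateBits 1 (M.kΛ + M.kΓ + 1 + 1) (List.ofFn fun c => (M.eW p n c : ℕ)) = _
  rw [ofFn_eW]
/-- The description of the placed `E` gate. [folklore] -/
theorem gateEnc_gE : RevDesc.gateEnc (M.gE p n) = RevDesc.gateBits 5 (M.kΛ + 1 + 1) (M.wiresE n) := by
  rw [gE, gateEnc_gate, encode_inr_hcOp]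
  show RevDesc.gateBits 5 (M.kΛ + 1 + 1) (List.ofFn fun c => (M.eE p n c : ℕ)) = _
  rw [ofFn_eE]
/-- The description of a placed controlled swap. [folklore] -/
theorem gateEnc_gCS (b : Bool) (j₁ j₂ : ℕ) (h₁ : j₁ < nw p n) (h₂ : j₂ < nw p n) (hne : j₁ ≠ j₂) :
    RevDesc.gateEnc (M.gCS p n b j₁ j₂ h₁ h₂ hne) =
      RevDesc.gateBits (if b then 7 else 9) (1 + M.kΓ + M.kΓ) (M.wiresCS n j₁ j₂) := by
  rw [gCS, gateEnc_gate, encode_inr_hcOp]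
  show RevDesc.gateBits (hcCode (HCOp.CS b)) (1 + M.kΓ + M.kΓ) (List.ofFn fun c => (M.eCS p n j₁ j₂ h₁ h₂ hne c : ℕ)) = _
  rw [ofFn_eCS]
  cases b <;> rfl
/-- The description of a placed load gate. [folklore] -/
theorem gateEnc_gLD (i : Fin n) : RevDesc.gateEnc (M.gLD p n i) = RevDesc.gateBits 11 (1 + M.kΓ) (M.wiresLD n i.val) := by
  rw [gLD, gateEnc_gate, encode_inr_hcOp]
  show RevDesc.gateBits 11 (1 + M.kΓ) (List.ofFn fun c => (M.eLD p n i c : ℕ)) = _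
  rw [ofFn_eLD]
/-- The description of the placed readout gate. [folklore] -/
theorem gateEnc_gAC : RevDesc.gateEnc (M.gAC p n) = RevDesc.gateBits 13 (M.kΛ + 1) (M.wiresAC n) := by
  rw [gAC, gateEnc_gate, encode_inr_hcOp]
  show RevDesc.gateBits 13 (M.kΛ + 1) (List.ofFn fun c => (M.eAC p n c : ℕ)) = _
  rw [ofFn_eAC]
/-- The description of a placed final swap. [folklore] -/
theorem gateEnc_gSW (k : Fin n) : RevDesc.gateEnc (M.gSW p n k) = RevDesc.gateBits 15 2 (wiresSW k.val) := by
  rw [gSW, gateEnc_gate, encode_inr_hcOp]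
  show RevDesc.gateBits 15 2 (List.ofFn fun c => (M.eSW p n k c : ℕ)) = _
  rw [ofFn_eSW]

/-- The (symbol code, arity, wires) triples of one simulated step, in order. [folklore] -/
def stepTriples : List (ℕ × ℕ × List ℕ) :=
  [(1, M.kΛ + M.kΓ + 1 + 1, M.wiresW n)] ++
    (List.range (nw p n - 1)).map (fun j => (7, 1 + M.kΓ + M.kΓ, M.wiresCS n j (j + 1))) ++
    (List.range (nw p n - 1)).map (fun j => (9, 1 + M.kΓ + M.kΓ, M.wiresCS n 0 (j + 1))) ++
    [(5, M.kΛ + 1 + 1, M.wiresE n)]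

/-- The triples of the whole circuit on inputs of length `n`: loads, `p(n)` steps, readout, swaps. [folklore] -/
def descTriples : List (ℕ × ℕ × List ℕ) :=
  (List.range n).map (fun i => (11, 1 + M.kΓ, M.wiresLD n i)) ++
    (List.replicate (tm p n) (M.stepTriples p n)).flatten ++
    ([(13, M.kΛ + 1, M.wiresAC n)] ++ (List.range n).map (fun k => (15, 2, wiresSW k)))

/-- The description bits of a triple (`RevDesc.gateBits`). [folklore] -/
def bitsOf (t : ℕ × ℕ × List ℕ) : List Bool := RevDesc.gateBits t.1 t.2.1 t.2.2
/-- The description tokens of a triple (`RevDesc.gateToks`). [folklore] -/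
def toksOf (t : ℕ × ℕ × List ℕ) : List Tok := RevDesc.gateToks t.1 t.2.1 t.2.2

/-- The description of the right swap word. [folklore] -/
theorem flatMap_gateEnc_csGatesR : (M.csGatesR p n).flatMap RevDesc.gateEnc =
    (List.range (nw p n - 1)).flatMap (fun j => RevDesc.gateBits 7 (1 + M.kΓ + M.kΓ) (M.wiresCS n j (j + 1))) := by
  rw [csGatesR, List.flatMap_map, ← List.map_coe_finRange_eq_range, List.flatMap_map]
  congr 1
  funext j
  simp only [gateEnc_gCS, if_true]

/-- The description of the left (star) swap word. [folklore] -/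
theorem flatMap_gateEnc_csGatesL : (M.csGatesL p n).flatMap RevDesc.gateEnc =
    (List.range (nw p n - 1)).flatMap (fun j => RevDesc.gateBits 9 (1 + M.kΓ + M.kΓ) (M.wiresCS n 0 (j + 1))) := by
  rw [csGatesL, List.flatMap_map, ← List.map_coe_finRange_eq_range, List.flatMap_map]
  congr 1
  funext j
  simp only [gateEnc_gCS, Bool.false_eq_true, if_false]

/-- The description of the load stage. [folklore] -/
theorem flatMap_gateEnc_loadGates : (M.loadGates p n).flatMap RevDesc.gateEnc =
    (List.range n).flatMap (fun i => RevDesc.gateBits 11 (1 + M.kΓ) (M.wiresLD n i)) := by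
  rw [loadGates, List.flatMap_map, ← List.map_coe_finRange_eq_range, List.flatMap_map]
  congr 1
  funext i
  simp only [gateEnc_gLD]

/-- The description of the final stage. [folklore] -/
theorem flatMap_gateEnc_finalGates : (M.finalGates p n).flatMap RevDesc.gateEnc =
    RevDesc.gateBits 13 (M.kΛ + 1) (M.wiresAC n) ++
      (List.range n).flatMap (fun k => RevDesc.gateBits 15 2 (wiresSW k)) := by
  rw [finalGates, List.flatMap_append, List.flatMap_cons, List.flatMap_nil, List.append_nil, gateEnc_gAC,
    List.flatMap_map, ← List.map_coe_finRange_eq_range, List.flatMap_map]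
  congr 2
  funext k
  simp only [gateEnc_gSW]

/-- The description of one simulated step is the bits of `stepTriples`. [folklore] -/
theorem flatMap_gateEnc_stepGates :
    (M.stepGates p n).flatMap RevDesc.gateEnc = (M.stepTriples p n).flatMap bitsOf := by
  rw [stepGates, List.flatMap_append, List.flatMap_append, List.flatMap_append, flatMap_gateEnc_csGatesR,
    flatMap_gateEnc_csGatesL, List.flatMap_cons, List.flatMap_nil, List.append_nil, List.flatMap_cons,
    List.flatMap_nil, List.append_nil, gateEnc_gW, gateEnc_gE, stepTriples]
  all_goals simp only [List.flatMap_append, List.flatMap_cons, List.flatMap_nil, List.append_nil, List.flatMap_map,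
    bitsOf]

/-- **The description of the `n`-th simulating circuit is the concatenation of the bits of `descTriples n`** (Arora–Barak 2009, §6.1: circuits as gate lists). [cite: AroraBarak2009, §6.1] -/
theorem encode_hcCirc : QCircuit.encode (M.hcCirc p n) = (M.descTriples p n).flatMap bitsOf := by
  rw [hcCirc, encode_eq_flatMap, circGates, List.flatMap_append, List.flatMap_append, flatMap_gateEnc_loadGates,
    flatMap_gateEnc_finalGates, flatMap_flatten_replicate, flatMap_gateEnc_stepGates, descTriples,
    List.flatMap_append, List.flatMap_append, flatMap_flatten_replicate]
  all_goals simp only [List.flatMap_append, List.flatMap_cons, List.flatMap_nil, List.append_nil, List.flatMap_map,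
    bitsOf]

/-- Triple tokens render to triple bits. [folklore] -/
theorem render_flatMap_toksOf (l : List (ℕ × ℕ × List ℕ)) (B : List Tok) :
    Tok.render 0 (l.flatMap toksOf ++ B) = l.flatMap bitsOf ++ Tok.render 0 B := by
  induction l with
  | nil => rfl
  | cons t l ih => rw [List.flatMap_cons, List.append_assoc, toksOf, render_gateToks, ih, List.flatMap_cons, bitsOf,
      List.append_assoc]

/-- Triple tokens reset the numeral counter. [folklore] -/
theorem fin_flatMap_toksOf (l : List (ℕ × ℕ × List ℕ)) (B : List Tok) :
    Tok.fin 0 (l.flatMap toksOf ++ B) = Tok.fin 0 B := by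
  induction l with
  | nil => rfl
  | cons t l ih => rw [List.flatMap_cons, List.append_assoc, toksOf, fin_gateToks, ih]

end descriptions


/-! ### The generator program -/

section generator

open Literature.Computability.QuantumComplexity.RevSim (headerToks render_headerToks)

/-- The variables of the generator program: input length `n`, step `t`, gate index `j`, tick counter `i`, filler `u`. [folklore] -/
inductive UV where
  | xn | tt | jj | ii | uu
  deriving DecidableEq, Fintype

/-- Counter expressions of the generator. [folklore] -/
abbrev UE : Type := GExpr UV
/-- Generator statements over the token alphabet. [folklore] -/
abbrev US : Type := GStmt UV Tok

attribute [local simp] GExpr.eval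

variable (M : QTM) (p : Polynomial ℕ)

/-- Powers of an expression, as iterated products. [folklore] -/
def pwE (a : UE) : ℕ → UE
  | 0 => .const 1
  | m + 1 => .mul (pwE a m) a

/-- Value of a power expression. [folklore] -/
@[simp] theorem eval_pwE (env : UV → ℕ) (a : UE) : ∀ m : ℕ, (pwE a m).eval env = (a.eval env) ^ m
  | 0 => by simp [pwE]
  | m + 1 => by simp [pwE, eval_pwE env a m, pow_succ]

/-- The polynomial `p` as a counter expression `∑_k p_k n^k` (the time bound of `BQPQTM` is a polynomial, which a counter program evaluates). [folklore] -/
def polyE : UE :=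
  (List.range (p.natDegree + 1)).foldr (fun k acc => .add (.mul (.const (p.coeff k)) (pwE (.var .xn) k)) acc) (.const 0)

/-- Value of the partial polynomial expression. [folklore] -/
theorem eval_foldr_poly (env : UV → ℕ) (l : List ℕ) :
    (l.foldr (fun k acc => GExpr.add (.mul (.const (p.coeff k)) (pwE (.var UV.xn) k)) acc) (.const 0) : UE).eval env =
      (l.map fun k => p.coeff k * (env .xn) ^ k).sum := by
  induction l with
  | nil => simp
  | cons k l ih => simp [ih]

/-- **The polynomial expression evaluates to `p(n)`.** [folklore] -/
@[simp] theorem eval_polyE (env : UV → ℕ) : (polyE p).eval env = p.eval (env .xn) := by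
  rw [polyE, eval_foldr_poly, Polynomial.eval_eq_sum_range, ← List.sum_toFinset _ List.nodup_range,
    List.toFinset_range]

/-- The simulated time `p(n)` as an expression. [folklore] -/
def tmE : UE := polyE p
/-- `N - 1 = 2(n + p(n)) + 2` as an expression (no subtraction needed). [folklore] -/
def nm1E : UE := .add (.mul (.const 2) (.add (.var .xn) (tmE p))) (.const 2)
/-- The window size `N = 2(n + p(n)) + 3` as an expression. [folklore] -/
def nwE : UE := .add (.mul (.const 2) (.add (.var .xn) (tmE p))) (.const 3)
/-- The number of ancillas as an expression. [folklore] -/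
def ancE : UE := .add (.const (1 + M.kΛ + 1 + 1)) (.mul (nwE p) (.const M.kΓ))

/-- Value of `tmE`. [folklore] -/
@[simp] theorem eval_tmE (env : UV → ℕ) : (tmE p).eval env = tm p (env .xn) := by simp [tmE, tm]
/-- Value of `nm1E`. [folklore] -/
@[simp] theorem eval_nm1E (env : UV → ℕ) : (nm1E p).eval env = nw p (env .xn) - 1 := by simp [nm1E, nw]
/-- Value of `nwE`. [folklore] -/
@[simp] theorem eval_nwE (env : UV → ℕ) : (nwE p).eval env = nw p (env .xn) := by simp [nwE, nw]
/-- Value of `ancE`. [folklore] -/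
@[simp] theorem eval_ancE (env : UV → ℕ) : (M.ancE p).eval env = M.anc p (env .xn) := by simp [ancE, anc]

/-- State wire numbers as expressions. [folklore] -/
def wStE (b : ℕ) : UE := .add (.var .xn) (.const (1 + b))
/-- The direction wire number as an expression. [folklore] -/
def wDE : UE := .add (.var .xn) (.const (1 + M.kΛ))
/-- The marker wire number as an expression. [folklore] -/
def wEE : UE := .add (.var .xn) (.const (1 + M.kΛ + 1))
/-- Cell wire numbers as expressions (block index an expression, bit a constant). [folklore] -/
def wCellE (jE : UE) (b : ℕ) : UE := .add (.var .xn) (.add (.const (1 + M.kΛ + 1 + 1 + b)) (.mul (.const M.kΓ) jE))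

/-- Value of `wStE`. [folklore] -/
@[simp] theorem eval_wStE (env : UV → ℕ) (b : ℕ) : (wStE b).eval env = wSt (env .xn) b := by simp [wStE, wSt]
/-- Value of `wDE`. [folklore] -/
@[simp] theorem eval_wDE (env : UV → ℕ) : (M.wDE).eval env = M.wD (env .xn) := by simp [wDE, wD]
/-- Value of `wEE`. [folklore] -/
@[simp] theorem eval_wEE (env : UV → ℕ) : (M.wEE).eval env = M.wE (env .xn) := by simp [wEE, wE]
/-- Value of `wCellE`. [folklore] -/
@[simp] theorem eval_wCellE (env : UV → ℕ) (jE : UE) (b : ℕ) :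
    (M.wCellE jE b).eval env = M.wCell (env .xn) (jE.eval env) b := by
  simp [wCellE, wCell]; ring

/-- Pin wires of `W` as expressions. [folklore] -/
def wiresWE : List UE := (List.range M.kΛ).map wStE ++ (List.range M.kΓ).map (M.wCellE (.const 0)) ++ [M.wDE] ++ [M.wEE]
/-- Pin wires of `E` as expressions. [folklore] -/
def wiresEE : List UE := (List.range M.kΛ).map wStE ++ [M.wDE] ++ [M.wEE]
/-- Pin wires of a controlled swap as expressions. [folklore] -/
def wiresCSE (j₁ j₂ : UE) : List UE := [M.wDE] ++ (List.range M.kΓ).map (M.wCellE j₁) ++ (List.range M.kΓ).map (M.wCellE j₂)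
/-- Pin wires of a load gate as expressions. [folklore] -/
def wiresLDE (iE : UE) : List UE := [iE] ++ (List.range M.kΓ).map (M.wCellE iE)
/-- Pin wires of the readout gate as expressions. [folklore] -/
def wiresACE : List UE := (List.range M.kΛ).map wStE ++ [.var .xn]
/-- Pin wires of a final swap as expressions. [folklore] -/
def wiresSWE (kE : UE) : List UE := [.const 0] ++ [.add kE (.const 1)]

/-- Values of `wiresWE`. [folklore] -/
theorem map_eval_wiresWE (env : UV → ℕ) : (M.wiresWE).map (GExpr.eval env) = M.wiresW (env .xn) := by
  simp [wiresWE, wiresW, List.map_map, Function.comp_def]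
/-- Values of `wiresEE`. [folklore] -/
theorem map_eval_wiresEE (env : UV → ℕ) : (M.wiresEE).map (GExpr.eval env) = M.wiresE (env .xn) := by
  simp [wiresEE, wiresE, List.map_map, Function.comp_def]
/-- Values of `wiresCSE`. [folklore] -/
theorem map_eval_wiresCSE (env : UV → ℕ) (j₁ j₂ : UE) :
    (M.wiresCSE j₁ j₂).map (GExpr.eval env) = M.wiresCS (env .xn) (j₁.eval env) (j₂.eval env) := by
  simp [wiresCSE, wiresCS, List.map_map, Function.comp_def]
/-- Values of `wiresLDE`. [folklore] -/
theorem map_eval_wiresLDE (env : UV → ℕ) (iE : UE) :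
    (M.wiresLDE iE).map (GExpr.eval env) = M.wiresLD (env .xn) (iE.eval env) := by
  simp [wiresLDE, wiresLD, List.map_map, Function.comp_def]
/-- Values of `wiresACE`. [folklore] -/
theorem map_eval_wiresACE (env : UV → ℕ) : (M.wiresACE).map (GExpr.eval env) = M.wiresAC (env .xn) := by
  simp [wiresACE, wiresAC, List.map_map, Function.comp_def]
/-- Values of `wiresSWE`. [folklore] -/
theorem map_eval_wiresSWE (env : UV → ℕ) (kE : UE) : (wiresSWE kE).map (GExpr.eval env) = wiresSW (kE.eval env) := by
  simp [wiresSWE, wiresSW]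

/-- `w` ticks (a unary count that the token renderer turns into a binary numeral). [folklore] -/
def ticksG (w : UE) : US := .loop .ii w (.emit [Tok.tick])

/-- The stream of `ticksG`. [folklore] -/
@[simp] theorem out_ticksG (w : UE) (env : UV → ℕ) : (ticksG w).out env = List.replicate (w.eval env) Tok.tick := by
  simp [ticksG, GStmt.out, flatMap_range_const]

/-- One wire index: ticks, dump, separator (as `RevSim.wireG`). [folklore] -/
def wireG (w : UE) : US := .seq (ticksG w) (.emit (Tok.dump true true :: RevDesc.litT [false, false, true, true]))

/-- The stream of `wireG` is `RevDesc.wireToks`. [folklore] -/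
@[simp] theorem out_wireG (w : UE) (env : UV → ℕ) : (wireG w).out env = RevDesc.wireToks (w.eval env) := by
  simp [wireG, GStmt.out, RevDesc.wireToks]

/-- One placed gate: literal symbol/arity prefix, the wires, the terminator (Arora–Barak 2009, proof of Thm. 6.15: output the description gate by gate, keeping counters). [cite: AroraBarak2009, §6.2 Thm. 6.15 (proof)] -/
def gateG (sc ar : ℕ) (ws : List UE) : US :=
  .seq (.emit (RevDesc.litT (RevDesc.gatePre sc ar))) (.seq (seqs (ws.map wireG)) (.emit (RevDesc.litT [false, true])))

/-- The stream of `gateG` is the token form of its triple. [folklore] -/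
@[simp] theorem out_gateG (sc ar : ℕ) (ws : List UE) (env : UV → ℕ) :
    (gateG sc ar ws).out env = toksOf (sc, ar, ws.map (GExpr.eval env)) := by
  simp [gateG, GStmt.out, toksOf, RevDesc.gateToks, List.flatMap_map]

/-- **The generator of one simulated step**: `W`, the right word (loop over `j < N-1`), the star word (loop over `j < N-1`), `E`. [folklore] -/
def stepG : US :=
  .seq (gateG 1 (M.kΛ + M.kΓ + 1 + 1) (M.wiresWE))
  (.seq (.loop .jj (nm1E p) (gateG 7 (1 + M.kΓ + M.kΓ) (M.wiresCSE (.var .jj) (.add (.var .jj) (.const 1)))))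
  (.seq (.loop .jj (nm1E p) (gateG 9 (1 + M.kΓ + M.kΓ) (M.wiresCSE (.const 0) (.add (.var .jj) (.const 1)))))
    (gateG 5 (M.kΛ + 1 + 1) (M.wiresEE))))

/-- The generator of the load stage (loop over the input positions). [folklore] -/
def loadG : US := .loop .jj (.var .xn) (gateG 11 (1 + M.kΓ) (M.wiresLDE (.var .jj)))

/-- The generator of the final stage: readout, then the `n` star swaps. [folklore] -/
def finalG : US :=
  .seq (gateG 13 (M.kΛ + 1) (M.wiresACE)) (.loop .jj (.var .xn) (gateG 15 2 (wiresSWE (.var .jj))))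

/-- The generator of the `sigmaEncode` header `dbl (bin n) ++ 01 ++ 1^{2 anc} ++ 01` (as `RevSim.headerG`). [folklore] -/
def headerG : US :=
  .seq (ticksG (.var .xn)) (.seq (.emit (Tok.dump false true :: RevDesc.litT [false, true]))
    (.seq (.loop .uu (.mul (.const 2) (M.ancE p)) (.emit [Tok.lit true])) (.emit (RevDesc.litT [false, true]))))

/-- **The generator program of the simulating family `hcFamily M p`**: header, loads, `p(n)` steps, final stage — nested counted loops with polynomial bounds. [cite: AroraBarak2009, §6.2 Thm. 6.15 (proof)] -/
def descG : US := .seq (M.headerG p) (.seq (M.loadG) (.seq (.loop .tt (tmE p) (M.stepG p)) (M.finalG)))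

/-- The step generator prints the tokens of `stepTriples`. [folklore] -/
theorem out_stepG (env : UV → ℕ) : (M.stepG p).out env = (M.stepTriples p (env .xn)).flatMap toksOf := by
  have h1 : ∀ j, Function.update env UV.jj j UV.xn = env .xn := fun j => by simp
  simp only [stepG, GStmt.out, out_gateG, map_eval_wiresWE, map_eval_wiresEE, map_eval_wiresCSE, GExpr.eval,
    Function.update_self, h1, eval_nm1E, stepTriples, List.flatMap_append, List.flatMap_cons, List.flatMap_nil,
    List.append_nil, List.flatMap_map]
  simp [List.append_assoc]

/-- The load generator prints the tokens of the load stage. [folklore] -/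
theorem out_loadG (env : UV → ℕ) :
    (M.loadG).out env = (List.range (env .xn)).flatMap (fun i => toksOf (11, 1 + M.kΓ, M.wiresLD (env .xn) i)) := by
  have h1 : ∀ j, Function.update env UV.jj j UV.xn = env .xn := fun j => by simp
  simp only [loadG, GStmt.out, out_gateG, map_eval_wiresLDE, GExpr.eval, Function.update_self, h1]

/-- The final generator prints the tokens of the final stage. [folklore] -/
theorem out_finalG (env : UV → ℕ) :
    (M.finalG).out env = toksOf (13, M.kΛ + 1, M.wiresAC (env .xn)) ++
      (List.range (env .xn)).flatMap (fun k => toksOf (15, 2, wiresSW k)) := by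
  simp only [finalG, GStmt.out, out_gateG, map_eval_wiresACE, map_eval_wiresSWE, GExpr.eval, Function.update_self]

/-- The header generator prints `RevSim.headerToks`. [folklore] -/
theorem out_headerG (env : UV → ℕ) :
    (M.headerG p).out env = headerToks (env .xn) (M.anc p (env .xn)) := by
  simp [headerG, GStmt.out, headerToks, flatMap_range_const]

/-- A constant block repeated by a counted loop. [folklore] -/
theorem flatMap_range_const_list {α : Type} (l : List α) :
    ∀ T : ℕ, ((List.range T).flatMap fun _ => l) = (List.replicate T l).flatten
  | 0 => rfl
  | T + 1 => by
    rw [List.range_succ, List.flatMap_append, flatMap_range_const_list l T, List.flatMap_singleton,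
      List.replicate_succ', List.flatten_append, List.flatten_singleton]

/-- **The generator prints the header followed by the tokens of `descTriples n`.** [folklore] -/
theorem out_descG (n : ℕ) :
    (M.descG p).out (GenProg.initEnv .xn n) = headerToks n (M.anc p n) ++ (M.descTriples p n).flatMap toksOf := by
  have hxt : ∀ t, Function.update (GenProg.initEnv UV.xn n) UV.tt t UV.xn = n := fun t => by simp
  have hloop : ((List.range (tm p n)).flatMap fun t => (M.stepG p).out (Function.update (GenProg.initEnv UV.xn n) UV.tt t)) =
      (List.replicate (tm p n) ((M.stepTriples p n).flatMap toksOf)).flatten := by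
    rw [show (fun t => (M.stepG p).out (Function.update (GenProg.initEnv UV.xn n) UV.tt t)) =
      fun _ => (M.stepTriples p n).flatMap toksOf from funext fun t => by rw [out_stepG, hxt]]
    exact flatMap_range_const_list _ _
  rw [descG, GStmt.out, GStmt.out, GStmt.out, GStmt.out, out_headerG, out_loadG, out_finalG, GenProg.initEnv_self,
    eval_tmE, GenProg.initEnv_self, hloop, descTriples, List.flatMap_append, List.flatMap_append,
    flatMap_flatten_replicate, List.flatMap_map, List.flatMap_append, List.flatMap_cons, List.flatMap_nil,
    List.append_nil, List.flatMap_map]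
  simp only [List.append_assoc]

/-- **The rendered stream of the generator is the description `sigmaEncode ⟨n, anc n, hcCirc n⟩` of the `n`-th circuit.** [cite: AroraBarak2009, §6.2 Thm. 6.15 (proof)] -/
theorem render_out_descG (n : ℕ) :
    Tok.render 0 ((M.descG p).out (GenProg.initEnv .xn n)) =
      QCircuit.sigmaEncode (G := M.hcGateSet) ⟨n, (M.hcFamily p).ancillas n, (M.hcFamily p).circ n⟩ := by
  rw [out_descG, render_headerToks, ← List.append_nil ((M.descTriples p n).flatMap toksOf), render_flatMap_toksOf,
    Tok.render_nil, List.append_nil, ← encode_hcCirc]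
  change _ = boolPair (encodeNat n) (boolPair (unaryEncodeNat (M.anc p n)) (QCircuit.encode (M.hcCirc p n)))
  rw [Literature.Computability.QuantumComplexity.RevDesc.boolPair_eq,
    Literature.Computability.QuantumComplexity.RevDesc.boolPair_eq,
    Literature.Computability.QuantumComplexity.RevDesc.unaryEncodeNat_eq_replicate, dbl_replicate]
  simp

end generator


/-! ### Loop-variable hygiene and uniformity -/

section hygiene

variable (M : QTM) (p : Polynomial ℕ)

/-- All loop variables of a statement satisfy `P`. [folklore] -/
def ULV (P : UV → Prop) (st : US) : Prop := ∀ x ∈ st.loopVars, P x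

variable {P : UV → Prop}

/-- `ULV` for an emission. [folklore] -/
theorem ulv_emit (ts : List Tok) : ULV P (.emit ts) := fun x hx => by simp [GStmt.loopVars] at hx
/-- `ULV` for a sequence. [folklore] -/
theorem ulv_seq {a b : US} (ha : ULV P a) (hb : ULV P b) : ULV P (.seq a b) := fun x hx => by
  simp only [GStmt.loopVars, List.mem_append] at hx
  exact hx.elim (ha x) (hb x)
/-- `ULV` for a loop. [folklore] -/
theorem ulv_loop {i : UV} {c : UE} {body : US} (hi : P i) (hb : ULV P body) : ULV P (.loop i c body) := fun x hx => by
  simp only [GStmt.loopVars, List.mem_cons] at hx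
  exact hx.elim (fun h => h ▸ hi) (hb x)
/-- `ULV` for `seqs`. [folklore] -/
theorem ulv_seqs {l : List US} (h : ∀ st ∈ l, ULV P st) : ULV P (seqs l) := fun x hx => by
  simp only [loopVars_seqs, List.mem_flatMap] at hx
  obtain ⟨st, hs, hx⟩ := hx
  exact h st hs x hx
/-- The only loop variable of a gate generator is the tick counter. [folklore] -/
theorem ulv_gateG (hi : P .ii) (sc ar : ℕ) (ws : List UE) : ULV P (gateG sc ar ws) :=
  ulv_seq (ulv_emit _) (ulv_seq (ulv_seqs fun st hs => by
    obtain ⟨w, _, rfl⟩ := List.mem_map.1 hs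
    exact ulv_seq (ulv_loop hi (ulv_emit _)) (ulv_emit _)) (ulv_emit _))

/-- Non-reuse of a loop from `ULV` of its body. [folklore] -/
theorem noReuse_loop_of' {i : UV} {c : UE} {body : US} (h1 : ULV (· ≠ i) body) (h2 : body.noReuse = true) :
    (GStmt.loop i c body).noReuse = true := by
  rw [GStmt.noReuse, h2, Bool.and_true, decide_eq_true_iff]
  exact fun h => h1 i h rfl
/-- Non-reuse of a sequence. [folklore] -/
theorem noReuse_seq_of' {a b : US} (ha : a.noReuse = true) (hb : b.noReuse = true) : (GStmt.seq a b).noReuse = true := by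
  rw [GStmt.noReuse, ha, hb, Bool.and_self]
/-- Gate generators do not reuse loop variables. [folklore] -/
theorem noReuse_gateG (sc ar : ℕ) (ws : List UE) : (gateG sc ar ws).noReuse = true :=
  noReuse_seq_of' rfl (noReuse_seq_of' (noReuse_seqs _ fun st hs => by
    obtain ⟨w, _, rfl⟩ := List.mem_map.1 hs; rfl) rfl)

/-- The loop variables of the step generator are `j` and `i`. [folklore] -/
theorem ulv_stepG (hi : P .ii) (hj : P .jj) : ULV P (M.stepG p) :=
  ulv_seq (ulv_gateG hi _ _ _) (ulv_seq (ulv_loop hj (ulv_gateG hi _ _ _)) (ulv_seq (ulv_loop hj (ulv_gateG hi _ _ _))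
    (ulv_gateG hi _ _ _)))
/-- The step generator does not reuse loop variables. [folklore] -/
theorem noReuse_stepG : (M.stepG p).noReuse = true :=
  noReuse_seq_of' (noReuse_gateG _ _ _) (noReuse_seq_of' (noReuse_loop_of' (ulv_gateG (by decide) _ _ _) (noReuse_gateG _ _ _))
    (noReuse_seq_of' (noReuse_loop_of' (ulv_gateG (by decide) _ _ _) (noReuse_gateG _ _ _)) (noReuse_gateG _ _ _)))
/-- The loop variables of the generator avoid the input variable `n`. [folklore] -/
theorem ulv_descG : ULV (· ≠ UV.xn) (M.descG p) :=
  ulv_seq (ulv_seq (ulv_loop (by decide) (ulv_emit _)) (ulv_seq (ulv_emit _) (ulv_seq (ulv_loop (by decide) (ulv_emit _))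
    (ulv_emit _))))
    (ulv_seq (ulv_loop (by decide) (ulv_gateG (by decide) _ _ _))
      (ulv_seq (ulv_loop (by decide) (M.ulv_stepG p (by decide) (by decide)))
        (ulv_seq (ulv_gateG (by decide) _ _ _) (ulv_loop (by decide) (ulv_gateG (by decide) _ _ _)))))
/-- `n` is not a loop variable of the generator. [folklore] -/
theorem xn_not_mem_loopVars_descG : UV.xn ∉ (M.descG p).loopVars := fun h => M.ulv_descG p _ h rfl
/-- The generator does not reuse loop variables. [folklore] -/
theorem noReuse_descG : (M.descG p).noReuse = true :=
  noReuse_seq_of' (noReuse_seq_of' rfl (noReuse_seq_of' rfl (noReuse_seq_of' rfl rfl)))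
    (noReuse_seq_of' (noReuse_loop_of' (ulv_gateG (by decide) _ _ _) (noReuse_gateG _ _ _))
      (noReuse_seq_of' (noReuse_loop_of' (M.ulv_stepG p (by decide) (by decide)) (M.noReuse_stepG p))
        (noReuse_seq_of' (noReuse_gateG _ _ _) (noReuse_loop_of' (ulv_gateG (by decide) _ _ _) (noReuse_gateG _ _ _)))))

/-- **The simulating circuit family `hcFamily M p` is polynomial-time uniform**: its description
`sigmaEncode ⟨n, anc n, hcCirc n⟩` is the rendered stream of the generator program `descG` (`render_out_descG`), hence
computable from `1ⁿ` in polynomial time (`GStmt.render_out_mem_FP`, `QCircuitFamily.isUniform_of_descFn_mem_FP`).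
Nishimura–Ozawa 2002, §4–§5 work with polynomial-time uniform circuit families throughout (their `BUPQC`); Arora–Barak
2009, §6.2 and proof of Thm. 6.15 is the construction pattern. [cite: AroraBarak2009, §6.2 Thm. 6.15 (proof)] -/
theorem hcFamily_isUniform : (M.hcFamily p).IsUniform := by
  refine QCircuitFamily.isUniform_of_descFn_mem_FP ?_
  have h := GStmt.render_out_mem_FP (M.descG p) .xn (M.xn_not_mem_loopVars_descG p) (M.noReuse_descG p)
  have e1 : (fun z : List Bool => Tok.render 0 ((M.descG p).out (GenProg.initEnv .xn z.length))) =
      (M.hcFamily p).descFn := by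
    funext z
    exact M.render_out_descG p z.length
  rw [e1] at h
  exact h

end hygiene

end QTM

end Literature.Computability.Cryptography

end
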